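import Mathlib
import Summits.Ventures.HodgeRepro2.T5RamifiedNormBelow
import Summits.Ventures.HodgeRepro2.T5RamifiedOddConductor

/-!
# THE EXACT CONDUCTOR OF `η_v` AT A RAMIFIED PLACE: `f(η_v) = v_E(σ π − π)` (T5WildConductor)

Setting as T5RamifiedNormBelow. With `i ≥ 1`, `v(σ π − π) = exp(−i)` and `f = normCharConductor v w σ ϖ hind` (row 169,
the conductor exponent of the norm character `η_v`):
* TAME (`2 ∈ O_{K_v}^×`): `f = 1` (row 169) and `i = 1` (T5RamifiedBreak).
* WILD: `f ≤ i` (T5RamifiedNormAbove) and `i ≤ f` — here: `U_F^{(i−1)} ⊄ N(L_w^×)` by T5RamifiedNormBelow applied to the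
  data `z = ϖ^s π, A = ϖ^s Tr π, B = ϖ^{2s} N π` (Case A, `t = i − 1 = 2s + 1`) or `z = ϖ^e, A = 2 ϖ^e, B = ϖ^{2e}`
  (Case B, `t = 2e`), whose values are all `exp(−t)` exactly.
So **`f(η_v) = i`** at every ramified place. `i = v_E(σ π − π) = v_E(f'(π))` is the different exponent
`v_E(𝔇_{E_v/F_v})` and `t = i − 1` the ramification break: this is the conductor–discriminant formula `a(η_v) = t + 1`
for a quadratic extension of local fields ([FM21-Thm-1.1] at a wild place, `a(η_v) = 1` at a tame one), in kernel,
from `[L_w : K_v] = 2`, the uniformisers and `σ ≠ 1` alone (no different ideal, no local class field theory).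
* COROLLARY (the route's Lemma N5.L4 (iv-a) as printed): the conjugate-symplectic `ω̃` of T5RamifiedOddConductor has
  conductor EXACTLY `2t + 1` with `t = i − 1` the break (`exists_CS_conductor_eq_break`).
-/

namespace Summit.Ventures.HodgeRepro2.T5WildConductor

open IsDedekindDomain HeightOneSpectrum
open Summit.Ventures.HodgeRepro2.T5RamifiedIntegralBasis Summit.Ventures.HodgeRepro2.T5RamifiedBreak
open Summit.Ventures.HodgeRepro2.T5NormCharConductor Summit.Ventures.HodgeRepro2.T5RamifiedNormAbove
open Summit.Ventures.HodgeRepro2.T5RamifiedNormEstimates Summit.Ventures.HodgeRepro2.T5RamifiedNormBelow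

variable {K : Type*} [Field K] [NumberField K] (v : HeightOneSpectrum (NumberField.RingOfIntegers K))
  {L : Type*} [Field L] [NumberField L] [Algebra K L] (w : HeightOneSpectrum (NumberField.RingOfIntegers L))
  [w.asIdeal.LiesOver v.asIdeal]
  [ContinuousSMul (v.adicCompletion K) (w.adicCompletion L)]

noncomputable section

section Wild

variable [IsScalarTower K (v.adicCompletion K) (w.adicCompletion L)]

/-! ### The data `(z, A, B)` in Case A / Case B, and `U_F^{(t)} ⊄ N(L_w^×)` -/

/-- `U_F^{(t)} ⊄ N(L_w^×)` at a WILD ramified place, `t = i − 1` (Case A: `z = ϖ^s π`, `t = 2s + 1`; Case B: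
`z = ϖ^e`, `t = 2e`). -/
theorem not_unitFiltration_le_normGroup (h2 : Module.finrank (v.adicCompletion K) (w.adicCompletion L) = 2)
    {ϖ : v.adicCompletionIntegers K} (hϖ : Irreducible ϖ) {π : w.adicCompletionIntegers L} (hπ : Irreducible π)
    (hram : ¬ Irreducible (algebraMap (v.adicCompletionIntegers K) (w.adicCompletionIntegers L) ϖ))
    (σ : (w.adicCompletion L) ≃ₐ[v.adicCompletion K] (w.adicCompletion L)) (hσ : σ ≠ 1)
    {i : ℕ} (hi : Valued.v (σ (π : w.adicCompletion L) - π) = WithZero.exp (-(i : ℤ)))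
    (e : ℕ) (he : Valued.v (2 : v.adicCompletion K) = WithZero.exp (-(e : ℤ))) (hie : i ≤ 2 * e + 1) (he1 : 1 ≤ e)
    {t : ℕ} (hti : i = t + 1) (ht1 : 1 ≤ t) (h2n : ¬ IsUnit (2 : v.adicCompletionIntegers K)) :
    ¬ unitFiltration v ϖ t ≤ T5AdicCompletionNormGroup.normGroup v w σ := by
  obtain ⟨τ, hτ⟩ := exists_algebraMap_eq_add_algEquiv v w h2 σ hσ (π : w.adicCompletion L)
  obtain ⟨ν, hν⟩ := exists_algebraMap_eq_mul_algEquiv v w h2 σ hσ (π : w.adicCompletion L)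
  have hνval := val_norm_uniformizer v w h2 hϖ hπ hram σ hν
  have hϖv : Valued.v (ϖ : v.adicCompletion K) = WithZero.exp (-1) := T5AdicCompletionNormGroup.val_uniformizer v hϖ
  rcases break_cases v w h2 hϖ hπ hram σ hτ hi e he with ⟨hτA, -⟩ | ⟨hiB, -⟩
  · -- Case A: `t = 2s + 1`
    obtain ⟨k, hk, hτval⟩ := exists_val_trace_eq v w h2 hϖ hπ hram hτA
    set s : ℕ := t / 2 with hs
    have hts : t = 2 * s + 1 := by omega
    have hks : k = -(s : ℤ) - 1 := by omega
    set ϖs : v.adicCompletion K := (ϖ : v.adicCompletion K) ^ s with hϖs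
    have hϖsv : Valued.v ϖs = WithZero.exp (-(s : ℤ)) := by
      rw [hϖs, map_pow, hϖv, ← WithZero.exp_nsmul]
      congr 1
      rw [nsmul_eq_mul]
      ring
    have hϖsalg : Valued.v (algebraMap (v.adicCompletion K) (w.adicCompletion L) ϖs) = WithZero.exp (-(2 * s : ℤ)) := by
      rw [T5RamifiedNormTransfer.val_algebraMap_eq_sq v w h2 hϖ hπ hram, hϖsv, ← WithZero.exp_nsmul]
      congr 1
      rw [nsmul_eq_mul]
      ring
    refine not_unitFiltration_le_normGroup_of_data v w h2 hϖ hπ hram σ hσ hi e he hie he1 hti ht1 h2n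
      (z := algebraMap (v.adicCompletion K) (w.adicCompletion L) ϖs * π) (A := ϖs * τ) (B := ϖs ^ 2 * ν)
      ?_ ?_ ?_ ?_ ?_
    · rw [map_mul, hϖsalg, T5AdicCompletionNormGroup.val_uniformizer w hπ, ← WithZero.exp_add]
      congr 1
      rw [hts]
      push_cast
      ring
    · rw [map_mul, hτ, map_mul, AlgEquiv.commutes]
      ring
    · rw [map_mul, map_pow, hν, map_mul, AlgEquiv.commutes]
      ring
    · rw [map_mul, hϖsv, hτval, ← WithZero.exp_add]
      congr 1
      rw [hks, hts]
      push_cast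
      ring
    · rw [map_mul, map_pow, hϖsv, hνval, ← WithZero.exp_nsmul, ← WithZero.exp_add]
      congr 1
      rw [nsmul_eq_mul, hts]
      push_cast
      ring
  · -- Case B: `t = 2e`
    have hte : t = 2 * e := by omega
    set ϖe : v.adicCompletion K := (ϖ : v.adicCompletion K) ^ e with hϖe
    have hϖev : Valued.v ϖe = WithZero.exp (-(e : ℤ)) := by
      rw [hϖe, map_pow, hϖv, ← WithZero.exp_nsmul]
      congr 1
      rw [nsmul_eq_mul]
      ring
    refine not_unitFiltration_le_normGroup_of_data v w h2 hϖ hπ hram σ hσ hi e he hie he1 hti ht1 h2n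
      (z := algebraMap (v.adicCompletion K) (w.adicCompletion L) ϖe) (A := 2 * ϖe) (B := ϖe ^ 2)
      ?_ ?_ ?_ ?_ ?_
    · rw [T5RamifiedNormTransfer.val_algebraMap_eq_sq v w h2 hϖ hπ hram, hϖev, ← WithZero.exp_nsmul]
      congr 1
      rw [nsmul_eq_mul, hte]
      push_cast
      ring
    · rw [map_mul, map_ofNat, AlgEquiv.commutes]
      ring
    · rw [map_pow, AlgEquiv.commutes]
      ring
    · rw [map_mul, he, hϖev, ← WithZero.exp_add]
      congr 1
      rw [hte]
      push_cast
      ring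
    · rw [map_pow, hϖev, ← WithZero.exp_nsmul]
      congr 1
      rw [nsmul_eq_mul, hte]
      push_cast
      ring

/-! ### `f(η_v) ≥ i` at a wild place, and `f(η_v) = i` at every ramified place -/

/-- **`i ≤ f(η_v)`** at a WILD ramified place. -/
theorem break_le_normCharConductor (h2 : Module.finrank (v.adicCompletion K) (w.adicCompletion L) = 2)
    {ϖ : v.adicCompletionIntegers K} (hϖ : Irreducible ϖ) {π : w.adicCompletionIntegers L} (hπ : Irreducible π)
    (hram : ¬ Irreducible (algebraMap (v.adicCompletionIntegers K) (w.adicCompletionIntegers L) ϖ))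
    (σ : (w.adicCompletion L) ≃ₐ[v.adicCompletion K] (w.adicCompletion L)) (hσ : σ ≠ 1)
    {i : ℕ} (hi : Valued.v (σ (π : w.adicCompletion L) - π) = WithZero.exp (-(i : ℤ)))
    (h2n : ¬ IsUnit (2 : v.adicCompletionIntegers K))
    (hind : (T5AdicCompletionNormGroup.normGroup v w σ).index = 2) :
    i ≤ normCharConductor v w σ ϖ hind := by
  obtain ⟨e, he⟩ := exists_val_two_eq v
  have hie := break_le_two_mul_add_one v w h2 hϖ hπ hram σ hσ hi e he
  have hf2 := two_le_normCharConductor_of_not_isUnit_two v w σ h2 hσ hϖ hπ hram hind h2n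
  have hfi := normCharConductor_le_break v w h2 hϖ hπ hram σ hσ hi hind
  have hti : i = (i - 1) + 1 := by omega
  have hnot := not_unitFiltration_le_normGroup v w h2 hϖ hπ hram σ hσ hi e he hie (by omega) hti (by omega) h2n
  by_contra hcon
  apply hnot
  intro y hy
  have hy' : y ∈ unitFiltration v ϖ (normCharConductor v w σ ϖ hind) :=
    unitFiltration_antitone v ϖ (by omega) hy
  have := unitFiltration_normCharConductor_le_ker v w σ hϖ hind hy'
  rw [MonoidHom.mem_ker, T5LocalNormCharacter.normChar_eq_one_iff] at this
  exact this

/-- **THE EXACT CONDUCTOR: `f(η_v) = i = v_E(σ π − π)` at EVERY ramified place** (tame: both are `1`; wild: the two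
inequalities). `i` is the different exponent `v_E(𝔇_{E_v/F_v}) = v_E(f'(π))`, `t = i − 1` the ramification break, so this
is the conductor–discriminant formula `a(η_v) = t + 1` for the quadratic extension `E_v/F_v` ([FM21-Thm-1.1] at a wild
place; `a(η_v) = 1` at a tame one), in kernel. -/
theorem normCharConductor_eq_break (h2 : Module.finrank (v.adicCompletion K) (w.adicCompletion L) = 2)
    {ϖ : v.adicCompletionIntegers K} (hϖ : Irreducible ϖ) {π : w.adicCompletionIntegers L} (hπ : Irreducible π)
    (hram : ¬ Irreducible (algebraMap (v.adicCompletionIntegers K) (w.adicCompletionIntegers L) ϖ))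
    (σ : (w.adicCompletion L) ≃ₐ[v.adicCompletion K] (w.adicCompletion L)) (hσ : σ ≠ 1)
    {i : ℕ} (hi1 : 1 ≤ i) (hi : Valued.v (σ (π : w.adicCompletion L) - π) = WithZero.exp (-(i : ℤ)))
    (hind : (T5AdicCompletionNormGroup.normGroup v w σ).index = 2) :
    normCharConductor v w σ ϖ hind = i := by
  by_cases h2u : IsUnit (2 : v.adicCompletionIntegers K)
  · rw [normCharConductor_eq_one_of_isUnit_two v w σ h2 hσ hϖ hπ hram hind h2u,
      break_eq_one_of_isUnit_two v w h2 hϖ hπ hram σ hσ hi1 hi h2u]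
  · exact le_antisymm (normCharConductor_le_break v w h2 hϖ hπ hram σ hσ hi hind)
      (break_le_normCharConductor v w h2 hϖ hπ hram σ hσ hi h2u hind)

/-- THE HEADLINE: at every ramified place `v(σ π − π) = exp(−f(η_v))` — the conductor exponent of the norm character
IS the exponent of `σ π − π` (the different), with `hind` supplied by row 167's uniform norm index theorem. -/
theorem val_algEquiv_sub_uniformizer_eq_exp_neg_normCharConductor
    (h2 : Module.finrank (v.adicCompletion K) (w.adicCompletion L) = 2)
    {ϖ : v.adicCompletionIntegers K} (hϖ : Irreducible ϖ) {π : w.adicCompletionIntegers L} (hπ : Irreducible π)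
    (hram : ¬ Irreducible (algebraMap (v.adicCompletionIntegers K) (w.adicCompletionIntegers L) ϖ))
    (σ : (w.adicCompletion L) ≃ₐ[v.adicCompletion K] (w.adicCompletion L)) (hσ : σ ≠ 1) :
    Valued.v (σ (π : w.adicCompletion L) - π) =
      WithZero.exp (-((normCharConductor v w σ ϖ (T5LocalNormIndex.index_normGroup_eq_two v w σ h2 hσ) : ℕ) : ℤ)) := by
  obtain ⟨i, hi1, hi⟩ := exists_val_algEquiv_sub_uniformizer_eq v w h2 hϖ hπ hram σ hσ
  rw [normCharConductor_eq_break v w h2 hϖ hπ hram σ hσ hi1 hi, hi]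

/-- THE ROUTE'S (iv-a) AS PRINTED: a conjugate-symplectic character of `L_w^×` (agreeing with `η_v` on `F_v^×`) of conductor
EXACTLY `2t + 1`, `t = i − 1` the ramification break (`v(σ π − π) = exp(−i)`), at every ramified place. -/
theorem exists_CS_conductor_eq_break (h2 : Module.finrank (v.adicCompletion K) (w.adicCompletion L) = 2)
    {ϖ : v.adicCompletionIntegers K} (hϖ : Irreducible ϖ) {π : w.adicCompletionIntegers L} (hπ : Irreducible π)
    (hram : ¬ Irreducible (algebraMap (v.adicCompletionIntegers K) (w.adicCompletionIntegers L) ϖ))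
    (σ : (w.adicCompletion L) ≃ₐ[v.adicCompletion K] (w.adicCompletion L)) (hσ : σ ≠ 1)
    {i : ℕ} (hi1 : 1 ≤ i) (hi : Valued.v (σ (π : w.adicCompletion L) - π) = WithZero.exp (-(i : ℤ))) :
    ∃ ω : (w.adicCompletion L)ˣ →* ℂˣ,
      (∀ f : T6.N5LocalInertCompletion.Fsub v w,
        ω f = T6.N5LocalInertCompletion.ηF v w σ (T5LocalNormIndex.index_normGroup_eq_two v w σ h2 hσ) f) ∧
      (∃ m, T6.N5LocalRamCompletion.Uπ w π m ≤ ω.ker) ∧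
      T5ConductorArithmetic.conductor (T6.N5LocalRamCompletion.Uπ w π) ω = 2 * (i - 1) + 1 := by
  obtain ⟨ω, hωF, hm, hc⟩ := T5RamifiedOddConductor.exists_CS_conductor_eq v w h2 hϖ hπ hram σ hσ
    (T5LocalNormIndex.index_normGroup_eq_two v w σ h2 hσ)
  refine ⟨ω, hωF, hm, ?_⟩
  rw [hc, normCharConductor_eq_break v w h2 hϖ hπ hram σ hσ hi1 hi]

end Wild

end

end Summit.Ventures.HodgeRepro2.T5WildConductor
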